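import Mathlib.Combinatorics.Additive.Energy
import Mathlib.Tactic
import HarnessLib

/-!
# Sumsets are large when no non-zero difference is popular (Cauchy–Schwarz on representations)

Topic `Literature/Combinatorics/Additive`. Fully proved, elementary (folklore; e.g. Tao–Vu,
*Additive Combinatorics*, §2.3: `|A|²|B|² ≤ |A + B| · E(A, B)` together with the fibrewise bound
`E(A, B) ≤ |A||B| + |B|² · max_{d ≠ 0} r_{A−A}(d)`).

* `addEnergy_le_of_popular` — if every non-zero difference `d` has at most `R` representations
  `d = a₁ − a₂` (`a₁, a₂ ∈ A`), then `E(A, B) ≤ |A||B| + |B|²R`;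
* `card_sq_mul_card_sq_le_of_popular` — hence `|A|²|B|² ≤ |A + B| (|A||B| + |B|² R)`, i.e.
  `|A + B| ≥ |A||B|/2` as soon as `|B| R ≤ |A|` (`card_mul_card_le_two_mul_card_add`).

Consumer: the spread-set energy bound of the DLOG band (crux `DlogGraphFlat`, `Summits/QuantumAdvantage`).
-/

namespace Literature.Combinatorics.Additive

open Finset
open scoped Combinatorics.Additive Pointwise

variable {G : Type*} [AddCommGroup G] [DecidableEq G]

/-- Fibrewise bound for the additive energy: `E(A,B) ≤ |A||B| + |B|² R` when every non-zero
difference has at most `R` representations in `A − A`. [folklore] -/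
theorem addEnergy_le_of_popular (A B : Finset G) (R : ℕ)
    (hR : ∀ d : G, d ≠ 0 → ((A ×ˢ A).filter fun x => x.1 - x.2 = d).card ≤ R) :
    Finset.addEnergy A B ≤ A.card * B.card + B.card * B.card * R := by
  classical
  unfold Finset.addEnergy
  set T := ((A ×ˢ A) ×ˢ B ×ˢ B).filter fun x : (G × G) × G × G => x.1.1 + x.2.1 = x.1.2 + x.2.2
    with hT
  have hmaps : ∀ x ∈ T, x.2 ∈ B ×ˢ B := by
    intro x hx
    rw [hT, Finset.mem_filter, Finset.mem_product] at hx
    exact hx.1.2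
  rw [Finset.card_eq_sum_card_fiberwise hmaps]
  have hfib : ∀ q ∈ B ×ˢ B,
      (T.filter fun x => x.2 = q).card ≤ if q.1 = q.2 then A.card else R := by
    intro q hq
    -- the fibre injects into {(a₁,a₂) ∈ A × A : a₁ - a₂ = q.2 - q.1} via x ↦ x.1
    have hinj : (T.filter fun x => x.2 = q).card ≤
        ((A ×ˢ A).filter fun y => y.1 - y.2 = q.2 - q.1).card := by
      refine Finset.card_le_card_of_injOn (fun x => x.1) ?_ ?_
      · intro x hx
        rw [Finset.mem_coe, Finset.mem_filter, hT, Finset.mem_filter, Finset.mem_product] at hx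
        rw [Finset.mem_coe, Finset.mem_filter]
        refine ⟨hx.1.1.1, ?_⟩
        have e := hx.1.2
        rw [hx.2] at e
        rw [sub_eq_sub_iff_add_eq_add, e, add_comm]
      · intro x hx x' hx' h
        rw [Finset.mem_coe, Finset.mem_filter] at hx hx'
        exact Prod.ext h (hx.2.trans hx'.2.symm)
    refine hinj.trans ?_
    split_ifs with hq'
    · -- q.1 = q.2: the pairs are diagonal, at most |A| of them
      refine (Finset.card_le_card_of_injOn (fun y => y.1) ?_ ?_)
      · intro y hy
        rw [Finset.mem_coe, Finset.mem_filter, Finset.mem_product] at hy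
        exact hy.1.1
      · intro y hy y' hy' h
        rw [Finset.mem_coe, Finset.mem_filter, hq', sub_self, sub_eq_zero] at hy hy'
        have h' : y.1 = y'.1 := h
        exact Prod.ext h' (hy.2.symm.trans (h'.trans hy'.2))
    · exact hR _ (sub_ne_zero.mpr (Ne.symm hq'))
  calc ∑ q ∈ B ×ˢ B, (T.filter fun x => x.2 = q).card
      ≤ ∑ q ∈ B ×ˢ B, (if q.1 = q.2 then A.card else R) := Finset.sum_le_sum hfib
    _ ≤ ∑ q ∈ B ×ˢ B, ((if q.1 = q.2 then A.card else 0) + R) := by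
        refine Finset.sum_le_sum fun q _ => ?_
        split_ifs <;> omega
    _ = ∑ q ∈ B ×ˢ B, (if q.1 = q.2 then A.card else 0) + (B ×ˢ B).card * R := by
        rw [Finset.sum_add_distrib, Finset.sum_const, smul_eq_mul]
    _ ≤ A.card * B.card + B.card * B.card * R := by
        rw [Finset.card_product]
        refine Nat.add_le_add_right ?_ _
        rw [← Finset.sum_filter]
        have hdiag : ((B ×ˢ B).filter fun q : G × G => q.1 = q.2).card ≤ B.card := by
          refine Finset.card_le_card_of_injOn (fun q => q.1) ?_ ?_
          · intro q hq
            rw [Finset.mem_coe, Finset.mem_filter, Finset.mem_product] at hq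
            exact hq.1.1
          · intro q hq q' hq' h
            rw [Finset.mem_coe, Finset.mem_filter] at hq hq'
            have h' : q.1 = q'.1 := h
            exact Prod.ext h' (hq.2.symm.trans (h'.trans hq'.2))
        calc ∑ q ∈ (B ×ˢ B).filter (fun q : G × G => q.1 = q.2), A.card
            = ((B ×ˢ B).filter fun q : G × G => q.1 = q.2).card * A.card := by
              rw [Finset.sum_const, smul_eq_mul]
          _ ≤ B.card * A.card := Nat.mul_le_mul_right _ hdiag
          _ = A.card * B.card := Nat.mul_comm _ _

/-- `|A|²|B|² ≤ |A + B| · (|A||B| + |B|² R)` under the popular-difference bound `R`. [folklore] -/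
theorem card_sq_mul_card_sq_le_of_popular (A B : Finset G) (R : ℕ)
    (hR : ∀ d : G, d ≠ 0 → ((A ×ˢ A).filter fun x => x.1 - x.2 = d).card ≤ R) :
    A.card ^ 2 * B.card ^ 2 ≤ (A + B).card * (A.card * B.card + B.card * B.card * R) :=
  (Finset.le_card_add_mul_addEnergy A B).trans
    (Nat.mul_le_mul_left _ (addEnergy_le_of_popular A B R hR))

/-- Expansion form: if `|B| R ≤ |A|` then `|A||B| ≤ 2 |A + B|`. [folklore] -/
theorem card_mul_card_le_two_mul_card_add (A B : Finset G) (R : ℕ)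
    (hR : ∀ d : G, d ≠ 0 → ((A ×ˢ A).filter fun x => x.1 - x.2 = d).card ≤ R)
    (hBR : B.card * R ≤ A.card) : A.card * B.card ≤ 2 * (A + B).card := by
  have h := card_sq_mul_card_sq_le_of_popular A B R hR
  have h2 : A.card * B.card + B.card * B.card * R ≤ 2 * (A.card * B.card) := by
    have : B.card * B.card * R = B.card * (B.card * R) := by ring
    rw [this]
    nlinarith [Nat.mul_le_mul_left B.card hBR]
  by_cases h0 : A.card * B.card = 0
  · rw [h0]; exact Nat.zero_le _
  · have hpos : 0 < A.card * B.card := Nat.pos_of_ne_zero h0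
    have h3 : (A.card * B.card) * (A.card * B.card) ≤ (A + B).card * (2 * (A.card * B.card)) := by
      calc (A.card * B.card) * (A.card * B.card) = A.card ^ 2 * B.card ^ 2 := by ring
        _ ≤ (A + B).card * (A.card * B.card + B.card * B.card * R) := h
        _ ≤ (A + B).card * (2 * (A.card * B.card)) := Nat.mul_le_mul_left _ h2
    have h4 : (A.card * B.card) * (A.card * B.card) ≤ (2 * (A + B).card) * (A.card * B.card) := by
      calc _ ≤ (A + B).card * (2 * (A.card * B.card)) := h3
        _ = (2 * (A + B).card) * (A.card * B.card) := by ring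
    exact Nat.le_of_mul_le_mul_right h4 hpos

end Literature.Combinatorics.Additive
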